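import Literature.Probability.LatticeModels.InnerFacesHoleFree
import Literature.Probability.LatticeModels.PlanarIsing
import HarnessLib

/-!
# The free sites of CHI's `+` volume `Ω_δ ∖ ∂Ω_δ` are hole-free when the exterior of `Ω̄` is connected

Topic `Literature/Probability/LatticeModels`. A geometric prerequisite of the lattice side of the
programme behind the Chelkak–Hongler–Izyurov facts `chi_onePoint_rho`, `chi_plusTwoPoint_*`,
`chi_freePlusTwoPoint_ratio`, `chi_twoPoint_free_jordan` (Ann. of Math. 181 (2015), "CHI15"): the
Kadanoff–Ceva constructions on the tree's discrete domains — admissible cut systems and the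
discrete primitive `H = Re ∫ F²` (`exists_kcCuts_primitive_mesh`, `IsingDisorderLaplacian.lean`),
Kramers–Wannier duality for disorder insertions (`KramersWannierDisorder.lean`) — all require the set
of free sites `meshInteriorFinset Ω δ = Ω_δ ∖ ∂Ω_δ` (the volume of `meshIsingPlusCorr`) to be
**hole-free as a set of cells** (`HoleFree`, `HoleFreePotential.lean`: every cell outside it is
joined to cells of arbitrary height through side-adjacent cells outside it — "simply connected
lattice domain", Smirnov 2010, §3; CHI15, §2.1), at EVERY mesh `δ`, and so far take it as a
hypothesis. This file proves it, at every mesh, for the domains on which that programme can run: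

**Theorem** (`holeFree_meshInteriorFinset`). *Let `Ω ⊆ ℂ` be open, with connected exterior
`(closure Ω)ᶜ` and `frontier Ω ⊆ closure (closure Ω)ᶜ` (every boundary point is a limit of exterior
points). Then for every `δ`, the set of free sites `meshInteriorFinset Ω δ` is hole-free.*

Both hypotheses hold for Jordan domains (`JordanDomain.exterior_of_JCT`,
`JordanDomain.frontier_subset_closure_exterior`, from the tree's Jordan curve theorem), whence
`JordanDomain.holeFree_meshInteriorFinset`; no approximation hypothesis and no smallness of `δ` is
needed (for unbounded `Ω` or `δ ≤ 0` the volume is empty and the statement is trivial).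

## Why not from `MeshApproximates`

The hypothesis cannot be replaced, scale by scale, by simple connectivity of the polygon of the free
sites (`IsSimplyConnected (meshInteriorPolygon Ω δ)`, the first clause of `MeshApproximates Ω`):
hole-freeness of a finite `Λ` says that `ℤ² ∖ Λ` is connected through LATTICE steps, simple
connectivity of the open polygon only that it is connected through `∗`-steps (closed cells of
`ℤ² ∖ Λ` touching at corners). A bounded simply connected `Ω` realising the difference at a given
mesh: remove from a square a closed "lake" of diameter `0.4 δ` meeting exactly one mesh segment
`[δb, δy]`, an exterior channel of width `0.2 δ` crossing the segments `{δk} × [δ(j+1), δ(j+2)]`,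
`k ≥ b₀ + 1`, `j = b₁`, and a thin filament joining them (invisible to the mesh, it lies in `Ω̄`):
then `{b, y}` is a frozen island of `ℤ² ∖ Λ` attached to the frozen strip only through the corner
`δ(b + (½, ½))`, the polygon is simply connected, and `Λ` is not hole-free. (Kramers–Wannier
duality is genuinely different there: the island spin is summed, not frozen, on the dual side.)
Under the present hypotheses such pinches cannot occur: every non-free site is joined by lattice
steps through non-free sites to the endpoints of a mesh segment met by the (single, connected)
exterior, and these escape.

## Proof (the enclosure argument of `InnerFacesHoleFree.lean`, for sites instead of faces)

Let `Λ` be the free sites, `g ∉ Λ`, and suppose the set `R` of sites reachable from `g` by lattice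
steps outside `Λ` has bounded height; it is then finite (`Λ` lies in a box). Let `K` be the union of
the closed plaquettes having a corner in `R`, and `V = (closure Ω)ᶜ`.
1. *Anatomy of `Λ`.* A free site lies in `Ω`, its four mesh segments lie in `Ω̄` and its four
   neighbours lie in `Ω_δ` (this is the definition of `∂Ω_δ`); a lattice neighbour of a site of `R`
   is in `R` or in `Λ`.
2. *`V` does not meet the interior of `K`* (`not_mem_interior_cellUnion`). Otherwise follow a
   path in the connected unbounded open set `V` from such a point to a point outside `K` and look at
   its last point `z ∈ K ∩ V`: no neighbourhood of `z` lies in `K`, so `z` is not in an open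
   plaquette of `K`, nor on an open side or at a corner all of whose plaquettes are in `K`; hence `z`
   lies on a side shared with a plaquette having no corner in `R`, or at such a corner — and the
   corner bookkeeping of step 1 puts an endpoint of that side, or that corner, in `Λ`, so the side
   lies in `Ω̄` (resp. the corner in `Ω`), contradicting `z ∈ V`.
3. *`V` meets the interior of `K`* (`exists_mem_interior_cellUnion`). Some site `x ∈ R` is either
   off `Ω` — then `δx`, an interior point of `K`, is a frontier or exterior point, and exterior
   points are dense near it — or has a mesh segment leaving `Ω̄` — then that segment, interior to
   `K`, carries an exterior point. Indeed, if every site of `R` were in `Ω` with its four segments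
   in `Ω̄`, then `g ∉ Λ` forces a site `x₀ ∈ R` outside `Ω_δ`; its whole mesh component misses
   `Ω_δ`, lies in `R`, and its topmost site has its upper neighbour off `Ω` yet in `R`.

Everything is proved; no named fact. [folklore] lattice topology; the statement is the standing
"simply connected discrete domain" assumption of CHI15 §2.1 / Smirnov 2010 §3 made a theorem for
the tree's discretisation scheme.

## References

* D. Chelkak, C. Hongler, K. Izyurov, *Conformal invariance of spin correlations in the planar
  Ising model*, Ann. of Math. 181 (2015) 1087–1138 = arXiv:1202.2838, §2.1 (discrete domains are
  simply connected unions of faces) — `ChelkakHonglerIzyurovAnnals2015`.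
* S. Smirnov, *Conformal invariance in random cluster models. I*, Ann. of Math. 172 (2010), §3
  ("connected and simply connected" lattice domains) — `Smirnov2010`.
-/

noncomputable section

namespace Literature.Probability.LatticeModels

open Set Metric Complex SimpleGraph Literature.Probability.RandomPlanarGeometry
  Literature.Probability.LatticeModels.Mesh

namespace MeshInteriorHoleFree

/-! ### Anatomy of the free sites `Ω_δ ∖ ∂Ω_δ` -/

section Anatomy

variable {Ω : Set ℂ} {δ : ℝ}

/-- A free site is joined in `Ω_δ` to each of its lattice neighbours (definition of `∂Ω_δ`).
[cite: ChelkakHonglerIzyurovAnnals2015, §1.2] -/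
theorem adj_of_mem {x y : Site 2} (hx : x ∈ meshInteriorFinset Ω δ) (hxy : (zdGraph 2).Adj x y) :
    (discreteDomainGraph Ω δ).Adj x y := by
  classical
  unfold meshInteriorFinset at hx
  split_ifs at hx with h
  · rw [Finset.mem_filter, Set.Finite.mem_toFinset] at hx
    obtain ⟨hxD, hxB⟩ := hx
    by_contra hadj
    exact hxB ⟨hxD, y, hxy, hadj⟩
  · simp at hx

/-- A free site lies in the discrete domain `Ω_δ`. [cite: ChelkakHonglerIzyurovAnnals2015, §1.2] -/
theorem mem_meshDomain_of_mem {x : Site 2} (hx : x ∈ meshInteriorFinset Ω δ) : x ∈ meshDomain Ω δ :=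
  (discreteDomainGraph_adj_iff.1 (adj_of_mem hx (zdGraph_adj_add_cornerUnit x 0))).2.1

/-- The lattice neighbours of a free site lie in `Ω_δ`. [cite: ChelkakHonglerIzyurovAnnals2015, §1.2] -/
theorem mem_meshDomain_of_adj {x y : Site 2} (hx : x ∈ meshInteriorFinset Ω δ) (hxy : (zdGraph 2).Adj x y) :
    y ∈ meshDomain Ω δ :=
  (discreteDomainGraph_adj_iff.1 (adj_of_mem hx hxy)).2.2

/-- The mesh segments at a free site lie in `Ω̄`. [cite: ChelkakHonglerIzyurovAnnals2015, §1.2] -/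
theorem segment_subset_of_mem {x y : Site 2} (hx : x ∈ meshInteriorFinset Ω δ) (hxy : (zdGraph 2).Adj x y) :
    segment ℝ (meshPoint δ x) (meshPoint δ y) ⊆ closure Ω :=
  (meshGraph_adj_iff.1 (discreteDomainGraph_le_meshGraph _ _ (adj_of_mem hx hxy))).2

/-- The mesh segment towards a free site lies in `Ω̄`. [cite: ChelkakHonglerIzyurovAnnals2015, §1.2] -/
theorem segment_subset_of_mem' {x y : Site 2} (hy : y ∈ meshInteriorFinset Ω δ) (hxy : (zdGraph 2).Adj x y) :
    segment ℝ (meshPoint δ x) (meshPoint δ y) ⊆ closure Ω := by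
  rw [segment_symm]
  exact segment_subset_of_mem hy hxy.symm

/-- A free site is a mesh vertex: its mesh point lies in `Ω`. [cite: ChelkakHonglerIzyurovAnnals2015, §1.2] -/
theorem meshPoint_mem_of_mem {x : Site 2} (hx : x ∈ meshInteriorFinset Ω δ) : meshPoint δ x ∈ Ω :=
  meshDomain_subset_meshVertices _ _ (mem_meshDomain_of_mem hx)

/-- Conversely (bounded `Ω`, `δ > 0`): a site outside the free set is outside `Ω_δ` or has a lattice
neighbour to which it is not joined in `Ω_δ`. [cite: ChelkakHonglerIzyurovAnnals2015, §1.2] -/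
theorem not_mem_cases (hΩ : Bornology.IsBounded Ω) (hδ : 0 < δ) {x : Site 2} (hx : x ∉ meshInteriorFinset Ω δ) :
    x ∉ meshDomain Ω δ ∨ ∃ y, (zdGraph 2).Adj x y ∧ ¬ (discreteDomainGraph Ω δ).Adj x y := by
  classical
  by_contra h
  push Not at h
  obtain ⟨hxD, hall⟩ := h
  apply hx
  unfold meshInteriorFinset
  rw [dif_pos ⟨hΩ, hδ⟩, Finset.mem_filter, Set.Finite.mem_toFinset]
  exact ⟨hxD, fun hB => by obtain ⟨-, y, hy, hn⟩ := hB; exact hn (hall y hy)⟩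

/-- The free set lies in a box. [folklore] -/
theorem exists_box (Ω : Set ℂ) (δ : ℝ) :
    ∃ X₁ X₂ Y₁ : ℤ, ∀ f : Site 2, f ∈ (↑(meshInteriorFinset Ω δ) : Set (Site 2)) → X₁ ≤ f 0 ∧ f 0 ≤ X₂ ∧ Y₁ ≤ f 1 := by
  have hfin : (↑(meshInteriorFinset Ω δ) : Set (Site 2)).Finite := Finset.finite_toSet _
  obtain ⟨X₂, hX₂⟩ := (hfin.image fun f => f 0).bddAbove
  obtain ⟨X₁, hX₁⟩ := (hfin.image fun f => f 0).bddBelow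
  obtain ⟨Y₁, hY₁⟩ := (hfin.image fun f => f 1).bddBelow
  exact ⟨X₁, X₂, Y₁, fun f hf => ⟨hX₁ ⟨f, hf, rfl⟩, hX₂ ⟨f, hf, rfl⟩, hY₁ ⟨f, hf, rfl⟩⟩⟩

/-- `Ω_δ` is a union of whole mesh components: it is closed under mesh-graph reachability among
mesh vertices. [cite: Smirnov2001, §2] -/
theorem mem_meshDomain_of_reachable' {x y : Site 2} (hx : x ∈ meshDomain Ω δ) {h₁ : x ∈ meshVertices Ω δ}
    {h₂ : y ∈ meshVertices Ω δ} (h : (meshVertexGraph Ω δ).Reachable ⟨x, h₁⟩ ⟨y, h₂⟩) : y ∈ meshDomain Ω δ := by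
  simp only [meshDomain, Set.mem_iUnion, Set.mem_image] at hx ⊢
  obtain ⟨C, hC, x', hx', hxx'⟩ := hx
  have : x' = ⟨x, h₁⟩ := Subtype.ext hxx'
  subst this
  refine ⟨C, hC, ⟨y, h₂⟩, ?_, rfl⟩
  rw [SimpleGraph.ConnectedComponent.mem_supp_iff] at hx' ⊢
  rw [← hx']
  exact SimpleGraph.ConnectedComponent.sound h.symm

end Anatomy

/-! ### The set of sites reachable outside a finite set: bounds -/

section Bounds

variable {P : Set (Site 2)} {g : Site 2} {X₁ X₂ Y₁ M : ℤ}

/-- If the sites reachable outside `P` from `g` have bounded height, none lies right of the box of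
`P` (it would escape straight up). [folklore] -/
theorem reach_fst_le (hbox : ∀ f : Site 2, f ∈ P → X₁ ≤ f 0 ∧ f 0 ≤ X₂ ∧ Y₁ ≤ f 1)
    (hg : g ∉ P) (hM : ∀ r, Relation.ReflTransGen (FaceStep P) g r → r 1 < M)
    {r : Site 2} (hr : Relation.ReflTransGen (FaceStep P) g r) : r 0 ≤ X₂ := by
  by_contra hlt
  push Not at hlt
  have hfree : ∀ n : ℕ, r + n • cornerUnit 1 ∉ P := by
    intro n hn
    have := (hbox _ hn).2.1
    rw [add_nsmul_cornerUnit_apply] at this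
    simp at this; omega
  obtain ⟨n, hn⟩ : ∃ n : ℕ, M ≤ r 1 + n := ⟨(M - r 1).toNat, by omega⟩
  have h := hM _ (reflTransGen_faceStep_nsmul hg hr 1 hfree n)
  rw [add_nsmul_cornerUnit_apply] at h
  simp at h; omega

/-- … and none lies left of the box. [folklore] -/
theorem reach_le_fst (hbox : ∀ f : Site 2, f ∈ P → X₁ ≤ f 0 ∧ f 0 ≤ X₂ ∧ Y₁ ≤ f 1)
    (hg : g ∉ P) (hM : ∀ r, Relation.ReflTransGen (FaceStep P) g r → r 1 < M)
    {r : Site 2} (hr : Relation.ReflTransGen (FaceStep P) g r) : X₁ ≤ r 0 := by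
  by_contra hlt
  push Not at hlt
  have hfree : ∀ n : ℕ, r + n • cornerUnit 1 ∉ P := by
    intro n hn
    have := (hbox _ hn).1
    rw [add_nsmul_cornerUnit_apply] at this
    simp at this; omega
  obtain ⟨n, hn⟩ : ∃ n : ℕ, M ≤ r 1 + n := ⟨(M - r 1).toNat, by omega⟩
  have h := hM _ (reflTransGen_faceStep_nsmul hg hr 1 hfree n)
  rw [add_nsmul_cornerUnit_apply] at h
  simp at h; omega

/-- … and none lies below the box (it would escape east, then up). [folklore] -/
theorem reach_le_snd (hbox : ∀ f : Site 2, f ∈ P → X₁ ≤ f 0 ∧ f 0 ≤ X₂ ∧ Y₁ ≤ f 1)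
    (hg : g ∉ P) (hM : ∀ r, Relation.ReflTransGen (FaceStep P) g r → r 1 < M)
    {r : Site 2} (hr : Relation.ReflTransGen (FaceStep P) g r) : Y₁ ≤ r 1 := by
  by_contra hlt
  push Not at hlt
  have hfree : ∀ n : ℕ, r + n • cornerUnit 0 ∉ P := by
    intro n hn
    have := (hbox _ hn).2.2
    rw [add_nsmul_cornerUnit_apply] at this
    simp at this; omega
  obtain ⟨n, hn⟩ : ∃ n : ℕ, X₂ < r 0 + n := ⟨(X₂ - r 0 + 1).toNat, by omega⟩
  have h := reach_fst_le hbox hg hM (reflTransGen_faceStep_nsmul hg hr 0 hfree n)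
  rw [add_nsmul_cornerUnit_apply] at h
  simp at h; omega

/-- The reachable set is finite. [folklore] -/
theorem finite_reach (hbox : ∀ f : Site 2, f ∈ P → X₁ ≤ f 0 ∧ f 0 ≤ X₂ ∧ Y₁ ≤ f 1)
    (hg : g ∉ P) (hM : ∀ r, Relation.ReflTransGen (FaceStep P) g r → r 1 < M) :
    {r | Relation.ReflTransGen (FaceStep P) g r}.Finite := by
  have hfin : (Set.Icc X₁ X₂ ×ˢ Set.Icc Y₁ M : Set (ℤ × ℤ)).Finite := (Set.finite_Icc _ _).prod (Set.finite_Icc _ _)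
  refine (hfin.preimage (f := fun r : Site 2 => (r 0, r 1)) fun r _ r' _ h => ?_).subset fun r hr => ?_
  · simp only [Prod.mk.injEq] at h
    exact funext fun i => by fin_cases i <;> simp [h.1, h.2]
  · simp only [Set.mem_preimage, Set.mem_prod, Set.mem_Icc]
    exact ⟨⟨reach_le_fst hbox hg hM hr, reach_fst_le hbox hg hM hr⟩, reach_le_snd hbox hg hM hr, (hM r hr).le⟩

/-- Closure property: a lattice neighbour of a reachable site is reachable or in `P`. [folklore] -/
theorem mem_of_adj_of_not_reach (hg : g ∉ P) {a b : Site 2} (ha : Relation.ReflTransGen (FaceStep P) g a)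
    (hab : (zdGraph 2).Adj a b) (hb : ¬ Relation.ReflTransGen (FaceStep P) g b) : b ∈ P := by
  by_contra hbP
  exact hb (reflTransGen_faceStep_step hg ha hab hbP)

end Bounds

/-! ### Corners of a plaquette: the two combinatorial facts -/

section Corners

/-- Two distinct corners of a plaquette are lattice-adjacent, or both adjacent to a third corner.
[folklore] -/
theorem corner_adj_or_exists (k j : ℤ) (a b a' b' : Bool) (hne : corner k j a b ≠ corner k j a' b') :
    (zdGraph 2).Adj (corner k j a' b') (corner k j a b) ∨
      ((zdGraph 2).Adj (corner k j a b') (corner k j a' b') ∧ (zdGraph 2).Adj (corner k j a b') (corner k j a b)) := by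
  have hh : ∀ b₀ : Bool, (zdGraph 2).Adj (corner k j false b₀) (corner k j true b₀) := zdGraph_adj_corner_horizontal k j
  have hv : ∀ a₀ : Bool, (zdGraph 2).Adj (corner k j a₀ false) (corner k j a₀ true) := zdGraph_adj_corner_vertical k j
  cases a <;> cases b <;> cases a' <;> cases b' <;>
    first
    | exact absurd rfl hne
    | exact Or.inl (hh _)
    | exact Or.inl (hh _).symm
    | exact Or.inl (hv _)
    | exact Or.inl (hv _).symm
    | exact Or.inr ⟨hh _, hv _⟩
    | exact Or.inr ⟨(hh _).symm, hv _⟩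
    | exact Or.inr ⟨hh _, (hv _).symm⟩
    | exact Or.inr ⟨(hh _).symm, (hv _).symm⟩

/-- A corner of a plaquette off a horizontal side of it is adjacent to an endpoint of that side.
[folklore] -/
theorem corner_adj_of_ne_horizontal (k j : ℤ) (b₀ a b : Bool) (h₁ : corner k j a b ≠ corner k j false b₀)
    (h₂ : corner k j a b ≠ corner k j true b₀) :
    (zdGraph 2).Adj (corner k j a b) (corner k j false b₀) ∨ (zdGraph 2).Adj (corner k j a b) (corner k j true b₀) := by
  have hv : ∀ a₀ : Bool, (zdGraph 2).Adj (corner k j a₀ false) (corner k j a₀ true) := zdGraph_adj_corner_vertical k j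
  cases a <;> cases b <;> cases b₀ <;>
    first
    | exact absurd rfl h₁
    | exact absurd rfl h₂
    | exact Or.inl (hv _)
    | exact Or.inl (hv _).symm
    | exact Or.inr (hv _)
    | exact Or.inr (hv _).symm

/-- A corner of a plaquette off a vertical side of it is adjacent to an endpoint of that side.
[folklore] -/
theorem corner_adj_of_ne_vertical (k j : ℤ) (a₀ a b : Bool) (h₁ : corner k j a b ≠ corner k j a₀ false)
    (h₂ : corner k j a b ≠ corner k j a₀ true) :
    (zdGraph 2).Adj (corner k j a b) (corner k j a₀ false) ∨ (zdGraph 2).Adj (corner k j a b) (corner k j a₀ true) := by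
  have hh : ∀ b₀ : Bool, (zdGraph 2).Adj (corner k j false b₀) (corner k j true b₀) := zdGraph_adj_corner_horizontal k j
  cases a <;> cases b <;> cases a₀ <;>
    first
    | exact absurd rfl h₁
    | exact absurd rfl h₂
    | exact Or.inl (hh _)
    | exact Or.inl (hh _).symm
    | exact Or.inr (hh _)
    | exact Or.inr (hh _).symm

/-- A corner of the plaquette `![k, j]` is `corner k j a b`. [folklore] -/
theorem exists_corner_eq_of_isCorner_vec {v : Site 2} {k j : ℤ} (h : IsCorner v ![k, j]) :
    ∃ a b : Bool, v = corner k j a b := by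
  obtain ⟨a, b, rfl⟩ := exists_corner_eq_of_isCorner h
  exact ⟨a, b, by simp⟩

end Corners

/-! ### The enclosure: plaquettes cornered at the reachable set -/

section Enclosure

variable {Ω : Set ℂ} {δ : ℝ} {g : Site 2}

/-- The plaquettes (indexed by lower-left corners) having a corner in `R`. [folklore] -/
def cornered (R : Set (Site 2)) : Set (Site 2) := {f | ∃ v ∈ R, IsCorner v f}

/-- The plaquettes cornered at a finite set form a finite set. [folklore] -/
theorem finite_cornered {R : Set (Site 2)} (hR : R.Finite) : (cornered R).Finite := by
  have : cornered R ⊆ ⋃ v ∈ R, Set.range (faceAt v) := by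
    rintro f ⟨v, hv, hvf⟩
    obtain ⟨i, hi⟩ := exists_faceAt_of_isCorner hvf
    exact Set.mem_biUnion hv ⟨i, hi.symm⟩
  exact (hR.biUnion fun v _ => Set.finite_range _).subset this

/-- The four plaquettes at a site of `R` are cornered at `R`; in coordinates. [folklore] -/
theorem mem_cornered_of_coords {R : Set (Site 2)} {v : Site 2} (hv : v ∈ R) {k' j' : ℤ}
    (hk' : k' = v 0 - 1 ∨ k' = v 0) (hj' : j' = v 1 - 1 ∨ j' = v 1) : (![k', j'] : Site 2) ∈ cornered R :=
  ⟨v, hv, isCorner_of_coords (by simpa using hk') (by simpa using hj')⟩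

/-- The open square around a site of `R` lies in the enclosure. [folklore] -/
theorem square_subset_cellUnion (hδ : 0 < δ) {R : Set (Site 2)} {v : Site 2} (hv : v ∈ R) :
    (Ioo (δ * (v 0 - 1)) (δ * (v 0 + 1)) ×ℂ Ioo (δ * (v 1 - 1)) (δ * (v 1 + 1))) ⊆ cellUnion δ (cornered R) := by
  have hK : ∀ k' j' : ℤ, (k' = v 0 - 1 ∨ k' = v 0) → (j' = v 1 - 1 ∨ j' = v 1) →
      closure (cell δ k' j') ⊆ cellUnion δ (cornered R) := by
    intro k' j' hk' hj'
    have := closure_cell_subset_cellUnion (δ := δ) (mem_cornered_of_coords hv hk' hj')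
    simpa using this
  have hsq := square_subset_closure_cells hδ (v 0) (v 1)
  refine hsq.trans (Set.union_subset (Set.union_subset ?_ ?_) (Set.union_subset ?_ ?_))
  · exact hK _ _ (Or.inl rfl) (Or.inl rfl)
  · exact hK _ _ (Or.inr rfl) (Or.inl rfl)
  · exact hK _ _ (Or.inl rfl) (Or.inr rfl)
  · exact hK _ _ (Or.inr rfl) (Or.inr rfl)

/-- The mesh point of a site of `R` is interior to the enclosure. [folklore] -/
theorem meshPoint_mem_interior_cellUnion (hδ : 0 < δ) {R : Set (Site 2)} {v : Site 2} (hv : v ∈ R) :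
    meshPoint δ v ∈ interior (cellUnion δ (cornered R)) := by
  refine interior_maximal (square_subset_cellUnion hδ hv) (isOpen_Ioo.reProdIm isOpen_Ioo) ?_
  rw [mem_reProdIm, meshPoint_re, meshPoint_im]
  refine ⟨⟨?_, ?_⟩, ?_, ?_⟩ <;> nlinarith

/-- The mesh segment between two adjacent sites of `R` is interior to the enclosure. [folklore] -/
theorem segment_subset_interior_cellUnion (hδ : 0 < δ) {R : Set (Site 2)} {v w : Site 2} (hv : v ∈ R) (hw : w ∈ R)
    (hvw : (zdGraph 2).Adj v w) : segment ℝ (meshPoint δ v) (meshPoint δ w) ⊆ interior (cellUnion δ (cornered R)) := by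
  have hSv := interior_maximal (square_subset_cellUnion hδ hv) (isOpen_Ioo.reProdIm isOpen_Ioo)
  have hSw := interior_maximal (square_subset_cellUnion hδ hw) (isOpen_Ioo.reProdIm isOpen_Ioo)
  rw [segment_eq_image]
  rintro z ⟨t, ⟨ht0, ht1⟩, rfl⟩
  obtain ⟨k, rfl⟩ := exists_eq_add_cornerUnit hvw
  -- coordinates of the point at parameter `t`
  have hre : ((1 - t) • meshPoint δ v + t • meshPoint δ (v + cornerUnit k)).re = δ * v 0 + t * (δ * cornerUnit k 0) := by
    simp only [add_re, Complex.real_smul, mul_re, ofReal_re, ofReal_im, zero_mul, sub_zero, meshPoint_re, Pi.add_apply]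
    push_cast; ring
  have him : ((1 - t) • meshPoint δ v + t • meshPoint δ (v + cornerUnit k)).im = δ * v 1 + t * (δ * cornerUnit k 1) := by
    simp only [add_im, Complex.real_smul, mul_im, ofReal_re, ofReal_im, zero_mul, add_zero, meshPoint_im, Pi.add_apply]
    push_cast; ring
  have hc : (cornerUnit k 0 = 1 ∧ cornerUnit k 1 = 0) ∨ (cornerUnit k 0 = 0 ∧ cornerUnit k 1 = 1) ∨
      (cornerUnit k 0 = -1 ∧ cornerUnit k 1 = 0) ∨ (cornerUnit k 0 = 0 ∧ cornerUnit k 1 = -1) := by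
    fin_cases k <;> simp [cornerUnit]
  by_cases ht : t < 1
  · -- near `v`
    apply hSv
    rw [mem_reProdIm, hre, him]
    rcases hc with ⟨h0, h1⟩ | ⟨h0, h1⟩ | ⟨h0, h1⟩ | ⟨h0, h1⟩ <;> rw [h0, h1] <;> push_cast <;>
      refine ⟨⟨?_, ?_⟩, ?_, ?_⟩ <;> nlinarith
  · -- `t = 1`: the point is `δ w`
    have ht1' : t = 1 := le_antisymm ht1 (not_lt.1 ht)
    apply hSw
    rw [mem_reProdIm, hre, him, ht1']
    simp only [Pi.add_apply, Int.cast_add, one_mul]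
    rcases hc with ⟨h0, h1⟩ | ⟨h0, h1⟩ | ⟨h0, h1⟩ | ⟨h0, h1⟩ <;> rw [h0, h1] <;> push_cast <;>
      refine ⟨⟨?_, ?_⟩, ?_, ?_⟩ <;> nlinarith

/-- **The exterior does not meet the interior of the enclosure.** See the module docstring,
step 2. [folklore] -/
theorem not_mem_interior_cellUnion (hδ : 0 < δ) (hg : g ∉ (↑(meshInteriorFinset Ω δ) : Set (Site 2)))
    (hΩb : Bornology.IsBounded Ω) (hV : IsConnected (closure Ω)ᶜ)
    (hRfin : {r | Relation.ReflTransGen (FaceStep (↑(meshInteriorFinset Ω δ) : Set (Site 2))) g r}.Finite)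
    {x : ℂ} (hxK : x ∈ interior (cellUnion δ (cornered {r | Relation.ReflTransGen (FaceStep (↑(meshInteriorFinset Ω δ) : Set (Site 2))) g r})))
    (hxV : x ∈ (closure Ω)ᶜ) : False := by
  classical
  set P : Set (Site 2) := ↑(meshInteriorFinset Ω δ) with hP
  set R : Set (Site 2) := {r | Relation.ReflTransGen (FaceStep P) g r} with hR
  set V : Set ℂ := (closure Ω)ᶜ with hVdef
  have hVopen : IsOpen V := isClosed_closure.isOpen_compl
  set K := cellUnion δ (cornered R) with hK
  have hQfin : (cornered R).Finite := finite_cornered hRfin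
  have hKcl : IsClosed K := isClosed_cellUnion δ hQfin
  have hKbdd : Bornology.IsBounded K := isBounded_cellUnion hδ hQfin
  have hrK : ∀ f ∈ cornered R, closure (cell δ (f 0) (f 1)) ⊆ K := fun f hf => closure_cell_subset_cellUnion hf
  -- a point of `V` outside `K`
  obtain ⟨ρ₁, hρ₁⟩ := hKbdd.subset_closedBall 0
  obtain ⟨ρ₂, hρ₂⟩ := hΩb.closure.subset_closedBall 0
  obtain ⟨w, hwV, hwK⟩ : ∃ w ∈ V, w ∉ K := by
    refine ⟨((max ρ₁ ρ₂ + 1 : ℝ) : ℂ), fun hw => ?_, fun hw => ?_⟩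
    · have h := hρ₂ hw
      rw [Metric.mem_closedBall, dist_zero_right, Complex.norm_real, Real.norm_eq_abs, abs_le] at h
      linarith [le_max_right ρ₁ ρ₂, h.2]
    · have h := hρ₁ hw
      rw [Metric.mem_closedBall, dist_zero_right, Complex.norm_real, Real.norm_eq_abs, abs_le] at h
      linarith [le_max_left ρ₁ ρ₂, h.2]
  -- a path in `V` from `x` to `w`, and its last time in `K`
  have hpc : IsPathConnected V := (hVopen.isConnected_iff_isPathConnected).1 hV
  obtain ⟨γ, hγV⟩ := hpc.joinedIn x hxV w hwV
  set T : Set ℝ := Icc (0 : ℝ) 1 ∩ γ.extend ⁻¹' K with hT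
  have hTcl : IsClosed T := isClosed_Icc.inter (hKcl.preimage γ.continuous_extend)
  have h0T : (0 : ℝ) ∈ T := by
    refine ⟨⟨le_rfl, zero_le_one⟩, ?_⟩
    show γ.extend 0 ∈ K
    rw [γ.extend_zero]
    exact interior_subset hxK
  have hTbdd : BddAbove T := ⟨1, fun t ht => ht.1.2⟩
  set t₀ := sSup T with ht₀
  have ht₀T : t₀ ∈ T := hTcl.csSup_mem ⟨0, h0T⟩ hTbdd
  have ht₀le : t₀ ≤ 1 := ht₀T.1.2
  have ht₀K : γ.extend t₀ ∈ K := ht₀T.2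
  have ht₀lt : t₀ < 1 := by
    rcases ht₀le.lt_or_eq with h | h
    · exact h
    · exfalso; rw [h, γ.extend_one] at ht₀K; exact hwK ht₀K
  set z := γ.extend t₀ with hz
  have hzV : z ∈ V := by rw [hz, γ.extend_apply ht₀T.1]; exact hγV _
  -- no open neighbourhood of `z` lies in `K`
  have key : ∀ U : Set ℂ, IsOpen U → z ∈ U → U ⊆ K → False := by
    intro U hU hzU hUK
    obtain ⟨t', ht', ht'1, ht'U⟩ := exists_gt_mem_of_continuous γ.continuous_extend ht₀lt hU hzU
    have ht'T : t' ∈ T := ⟨⟨ht₀T.1.1.trans ht'.le, ht'1⟩, hUK ht'U⟩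
    exact absurd (le_csSup hTbdd ht'T) (not_le.2 ht')
  have hzΩ : z ∉ closure Ω := hzV
  -- `z` lies in a closed plaquette cornered at `R`
  obtain ⟨r', hr'Q, hzr'⟩ : ∃ r' ∈ cornered R, z ∈ closure (cell δ (r' 0) (r' 1)) := by
    simpa only [hK, cellUnion, Set.mem_iUnion, exists_prop] using ht₀K
  -- the closure property of `R`, in the two forms used below
  have hcl : ∀ {a b : Site 2}, a ∈ R → (zdGraph 2).Adj a b → b ∉ R → b ∈ P := fun ha hab hb =>
    mem_of_adj_of_not_reach hg ha hab hb
  -- membership in `cornered R` in coordinates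
  have hQ_of : ∀ {v : Site 2}, v ∈ R → ∀ {k' j' : ℤ}, (k' = v 0 - 1 ∨ k' = v 0) → (j' = v 1 - 1 ∨ j' = v 1) →
      (![k', j'] : Site 2) ∈ cornered R := fun hv _ _ hk' hj' => mem_cornered_of_coords hv hk' hj'
  set k := r' 0 with hk
  set j := r' 1 with hj
  have hr'eq : r' = ![k, j] := funext fun i => by fin_cases i <;> simp [hk, hj]
  -- an `R`-corner of `r'`
  obtain ⟨u, huR, hur'⟩ := hr'Q
  rw [hr'eq] at hur'
  obtain ⟨a', b', hu⟩ := exists_corner_eq_of_isCorner_vec hur'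
  rw [closure_cell hδ, mem_reProdIm] at hzr'
  obtain ⟨hre, him⟩ := hzr'
  have hδk : δ * k < δ * (k + 1) := by nlinarith
  have hδj : δ * j < δ * (j + 1) := by nlinarith
  -- a segment with an endpoint in `P` lies in `Ω̄`
  have hsegP : ∀ {v₁ v₂ : Site 2}, (zdGraph 2).Adj v₁ v₂ → (v₁ ∈ P ∨ v₂ ∈ P) →
      segment ℝ (meshPoint δ v₁) (meshPoint δ v₂) ⊆ closure Ω := by
    rintro v₁ v₂ hadj (h | h)
    · exact segment_subset_of_mem h hadj
    · exact segment_subset_of_mem' h hadj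
  -- an endpoint of a side of `r'` off `R` and adjacent to `u` is in `P`
  have hP_of_adj : ∀ {v : Site 2}, v ∉ R → (zdGraph 2).Adj u v → v ∈ P := fun hv huv => hcl huR huv hv
  by_cases hreo : z.re ∈ Ioo (δ * k) (δ * (k + 1))
  · by_cases himo : z.im ∈ Ioo (δ * j) (δ * (j + 1))
    · -- in the open plaquette
      refine key _ (isOpen_cell δ k j) ⟨hreo, himo⟩ ((subset_closure).trans ?_)
      have := hrK _ ⟨u, huR, hur'⟩; simpa using this
    · -- on a horizontal open side at height `δ j₀`, `j₀ ∈ {j, j + 1}`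
      obtain ⟨j₀, hj₀, hj₀'⟩ : ∃ j₀ : ℤ, z.im = δ * j₀ ∧ (j₀ = j ∨ j₀ = j + 1) := by
        rcases eq_or_eq_of_mem_Icc_of_not_mem_Ioo him himo with h | h
        · exact ⟨j, h, Or.inl rfl⟩
        · exact ⟨j + 1, by rw [h]; push_cast; ring, Or.inr rfl⟩
      obtain ⟨b₀, hb₀⟩ : ∃ b₀ : Bool, j₀ = j + (if b₀ then 1 else 0) := by
        rcases hj₀' with h | h
        · exact ⟨false, by simp [h]⟩
        · exact ⟨true, by simp [h]⟩
      -- the side's endpoints and the other plaquette `![k, j']` across it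
      set v₁ : Site 2 := ![k, j₀] with hv₁
      set v₂ : Site 2 := ![k + 1, j₀] with hv₂
      have hv₁c : v₁ = corner k j false b₀ := funext fun i => by fin_cases i <;> simp [hv₁, corner, hb₀]
      have hv₂c : v₂ = corner k j true b₀ := funext fun i => by fin_cases i <;> simp [hv₂, corner, hb₀]
      have hvadj : (zdGraph 2).Adj v₁ v₂ := by rw [hv₁c, hv₂c]; exact zdGraph_adj_corner_horizontal k j b₀
      have hzseg : z ∈ segment ℝ (meshPoint δ v₁) (meshPoint δ v₂) := by
        rw [hv₁, hv₂, meshPoint_vec, meshPoint_vec]; push_cast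
        exact mem_segment_of_im_eq hδk hre hj₀
      set j' : ℤ := 2 * j₀ - j - 1 with hj'def
      -- the other plaquette has corners `v₁, v₂`
      have hc' : IsCorner v₁ ![k, j'] ∧ IsCorner v₂ ![k, j'] := by
        constructor <;> refine isCorner_of_coords ?_ ?_ <;> simp [hv₁, hv₂] <;> omega
      by_cases hother : (![k, j'] : Site 2) ∈ cornered R
      · -- both plaquettes across the side are in the enclosure: an open rectangle around `z`
        have h1 : closure (cell δ k j) ⊆ K := by have := hrK _ ⟨u, huR, hur'⟩; simpa using this
        have h2 : closure (cell δ k j') ⊆ K := by have := hrK _ hother; simpa using this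
        refine key _ (isOpen_Ioo.reProdIm isOpen_Ioo) ?_ ((rect_subset_closure_cells_h hδ k j₀).trans ?_)
        · rw [mem_reProdIm]; refine ⟨hreo, ?_, ?_⟩ <;> rw [hj₀] <;> nlinarith
        · rcases hj₀' with h | h
          · have hj'v : j' = j - 1 := by omega
            rw [hj'v] at h2; rw [h]
            exact Set.union_subset h2 h1
          · have hj'v : j' = j + 1 := by omega
            rw [hj'v] at h2; rw [h, show (j + 1 - 1 : ℤ) = j by ring]
            exact Set.union_subset h1 h2
      · -- the other plaquette has no corner in `R`: `v₁, v₂ ∉ R`, and `u` is adjacent to one of them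
        have hv₁R : v₁ ∉ R := fun h => hother ⟨v₁, h, hc'.1⟩
        have hv₂R : v₂ ∉ R := fun h => hother ⟨v₂, h, hc'.2⟩
        have hne₁ : corner k j a' b' ≠ corner k j false b₀ := fun h => hv₁R (by rw [hv₁c, ← h, ← hu]; exact huR)
        have hne₂ : corner k j a' b' ≠ corner k j true b₀ := fun h => hv₂R (by rw [hv₂c, ← h, ← hu]; exact huR)
        have hadj := corner_adj_of_ne_horizontal k j b₀ a' b' hne₁ hne₂
        rw [← hu, ← hv₁c, ← hv₂c] at hadj
        rcases hadj with h | h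
        · exact hzΩ (hsegP hvadj (Or.inl (hP_of_adj hv₁R h)) hzseg)
        · exact hzΩ (hsegP hvadj (Or.inr (hP_of_adj hv₂R h)) hzseg)
  · -- `z.re = δ k₀`, `k₀ ∈ {k, k + 1}`
    obtain ⟨k₀, hk₀, hk₀'⟩ : ∃ k₀ : ℤ, z.re = δ * k₀ ∧ (k₀ = k ∨ k₀ = k + 1) := by
      rcases eq_or_eq_of_mem_Icc_of_not_mem_Ioo hre hreo with h | h
      · exact ⟨k, h, Or.inl rfl⟩
      · exact ⟨k + 1, by rw [h]; push_cast; ring, Or.inr rfl⟩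
    obtain ⟨a₀, ha₀⟩ : ∃ a₀ : Bool, k₀ = k + (if a₀ then 1 else 0) := by
      rcases hk₀' with h | h
      · exact ⟨false, by simp [h]⟩
      · exact ⟨true, by simp [h]⟩
    by_cases himo : z.im ∈ Ioo (δ * j) (δ * (j + 1))
    · -- on a vertical open side at abscissa `δ k₀`
      set v₁ : Site 2 := ![k₀, j] with hv₁
      set v₂ : Site 2 := ![k₀, j + 1] with hv₂
      have hv₁c : v₁ = corner k j a₀ false := funext fun i => by fin_cases i <;> simp [hv₁, corner, ha₀]
      have hv₂c : v₂ = corner k j a₀ true := funext fun i => by fin_cases i <;> simp [hv₂, corner, ha₀]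
      have hvadj : (zdGraph 2).Adj v₁ v₂ := by rw [hv₁c, hv₂c]; exact zdGraph_adj_corner_vertical k j a₀
      have hzseg : z ∈ segment ℝ (meshPoint δ v₁) (meshPoint δ v₂) := by
        rw [hv₁, hv₂, meshPoint_vec, meshPoint_vec]; push_cast
        exact mem_segment_of_re_eq hδj him hk₀
      set k' : ℤ := 2 * k₀ - k - 1 with hk'def
      have hc' : IsCorner v₁ ![k', j] ∧ IsCorner v₂ ![k', j] := by
        constructor <;> refine isCorner_of_coords ?_ ?_ <;> simp [hv₁, hv₂] <;> omega
      by_cases hother : (![k', j] : Site 2) ∈ cornered R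
      · have h1 : closure (cell δ k j) ⊆ K := by have := hrK _ ⟨u, huR, hur'⟩; simpa using this
        have h2 : closure (cell δ k' j) ⊆ K := by have := hrK _ hother; simpa using this
        refine key _ (isOpen_Ioo.reProdIm isOpen_Ioo) ?_ ((rect_subset_closure_cells_v hδ k₀ j).trans ?_)
        · rw [mem_reProdIm]; refine ⟨⟨?_, ?_⟩, himo⟩ <;> rw [hk₀] <;> nlinarith
        · rcases hk₀' with h | h
          · have hk'v : k' = k - 1 := by omega
            rw [hk'v] at h2; rw [h]
            exact Set.union_subset h2 h1
          · have hk'v : k' = k + 1 := by omega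
            rw [hk'v] at h2; rw [h, show (k + 1 - 1 : ℤ) = k by ring]
            exact Set.union_subset h1 h2
      · have hv₁R : v₁ ∉ R := fun h => hother ⟨v₁, h, hc'.1⟩
        have hv₂R : v₂ ∉ R := fun h => hother ⟨v₂, h, hc'.2⟩
        have hne₁ : corner k j a' b' ≠ corner k j a₀ false := fun h => hv₁R (by rw [hv₁c, ← h, ← hu]; exact huR)
        have hne₂ : corner k j a' b' ≠ corner k j a₀ true := fun h => hv₂R (by rw [hv₂c, ← h, ← hu]; exact huR)
        have hadj := corner_adj_of_ne_vertical k j a₀ a' b' hne₁ hne₂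
        rw [← hu, ← hv₁c, ← hv₂c] at hadj
        rcases hadj with h | h
        · exact hzΩ (hsegP hvadj (Or.inl (hP_of_adj hv₁R h)) hzseg)
        · exact hzΩ (hsegP hvadj (Or.inr (hP_of_adj hv₂R h)) hzseg)
    · -- at the corner `v = ![k₀, j₀]` of `r'`
      obtain ⟨j₀, hj₀, hj₀'⟩ : ∃ j₀ : ℤ, z.im = δ * j₀ ∧ (j₀ = j ∨ j₀ = j + 1) := by
        rcases eq_or_eq_of_mem_Icc_of_not_mem_Ioo him himo with h | h
        · exact ⟨j, h, Or.inl rfl⟩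
        · exact ⟨j + 1, by rw [h]; push_cast; ring, Or.inr rfl⟩
      obtain ⟨b₀, hb₀⟩ : ∃ b₀ : Bool, j₀ = j + (if b₀ then 1 else 0) := by
        rcases hj₀' with h | h
        · exact ⟨false, by simp [h]⟩
        · exact ⟨true, by simp [h]⟩
      set v : Site 2 := ![k₀, j₀] with hv
      have hvc : v = corner k j a₀ b₀ := funext fun i => by fin_cases i <;> simp [hv, corner, ha₀, hb₀]
      have hzv : z = meshPoint δ v := by rw [hv, meshPoint_vec]; exact Complex.ext hk₀ hj₀
      by_cases hvR : v ∈ R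
      · -- all four plaquettes at `v` are in the enclosure: an open square around `z`
        refine key _ (isOpen_Ioo.reProdIm isOpen_Ioo) ?_ (square_subset_cellUnion hδ hvR)
        rw [hzv, mem_reProdIm, meshPoint_re, meshPoint_im]
        refine ⟨⟨?_, ?_⟩, ?_, ?_⟩ <;> nlinarith
      · -- `v ∉ R`: `u` is adjacent to `v`, or both are adjacent to a third corner `w'`
        have hne : corner k j a₀ b₀ ≠ corner k j a' b' := fun h => hvR (by rw [hvc, h, ← hu]; exact huR)
        rcases corner_adj_or_exists k j a₀ b₀ a' b' hne with h | ⟨hwu, hwv⟩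
        · -- `u ~ v`: `v ∈ P`, so `δ v ∈ Ω`
          rw [← hu, ← hvc] at h
          exact hzΩ (hzv ▸ subset_closure (meshPoint_mem_of_mem (hP_of_adj hvR h)))
        · rw [← hu] at hwu
          rw [← hvc] at hwv
          set w' : Site 2 := corner k j a₀ b' with hw'
          by_cases hwR : w' ∈ R
          · -- `v ~ w' ∈ R`, `v ∉ R`: `v ∈ P`
            exact hzΩ (hzv ▸ subset_closure (meshPoint_mem_of_mem (hcl hwR hwv hvR)))
          · -- `w' ∉ R`, `w' ~ u ∈ R`: `w' ∈ P`, and `δ v` is an endpoint of the segment at `w'`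
            have hw'P : w' ∈ P := hcl huR hwu.symm hwR
            exact hzΩ (segment_subset_of_mem hw'P hwv (hzv ▸ right_mem_segment ℝ _ _))

/-- **The exterior meets the interior of the enclosure.** See the module docstring, step 3.
[folklore] -/
theorem exists_mem_interior_cellUnion (hδ : 0 < δ) (hg : g ∉ (↑(meshInteriorFinset Ω δ) : Set (Site 2)))
    (hΩo : IsOpen Ω) (hΩb : Bornology.IsBounded Ω)
    (hJE : frontier Ω ⊆ closure (closure Ω)ᶜ)
    (hRfin : {r | Relation.ReflTransGen (FaceStep (↑(meshInteriorFinset Ω δ) : Set (Site 2))) g r}.Finite) :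
    ∃ x ∈ interior (cellUnion δ (cornered {r | Relation.ReflTransGen (FaceStep (↑(meshInteriorFinset Ω δ) : Set (Site 2))) g r})),
      x ∈ (closure Ω)ᶜ := by
  classical
  set P : Set (Site 2) := ↑(meshInteriorFinset Ω δ) with hP
  set R : Set (Site 2) := {r | Relation.ReflTransGen (FaceStep P) g r} with hR
  have hgR : g ∈ R := Relation.ReflTransGen.refl
  have hcl : ∀ {a b : Site 2}, a ∈ R → (zdGraph 2).Adj a b → b ∉ P → b ∈ R := fun ha hab hb =>
    reflTransGen_faceStep_step hg ha hab hb
  have hRP : ∀ {a : Site 2}, a ∈ R → a ∉ P := fun ha => not_mem_of_reflTransGen_faceStep hg ha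
  have hPfin : ∀ {a : Site 2}, a ∈ P ↔ a ∈ meshInteriorFinset Ω δ := fun {a} => Finset.mem_coe
  -- a witness: a site of `R` off `Ω`, or with a mesh segment leaving `Ω̄`
  have hwit : ∃ x ∈ R, meshPoint δ x ∉ Ω ∨ ∃ y, (zdGraph 2).Adj x y ∧ ¬ segment ℝ (meshPoint δ x) (meshPoint δ y) ⊆ closure Ω := by
    by_contra hall
    push Not at hall
    -- every site of `R` is a mesh vertex with its four segments in `Ω̄`
    have hmeshAdj : ∀ {x y : Site 2}, x ∈ R → (zdGraph 2).Adj x y → (meshGraph Ω δ).Adj x y :=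
      fun hx hxy => meshGraph_adj_iff.2 ⟨hxy, (hall _ hx).2 _ hxy⟩
    -- a site of `R` outside `Ω_δ`
    obtain ⟨x₀, hx₀R, hx₀D⟩ : ∃ x₀ ∈ R, x₀ ∉ meshDomain Ω δ := by
      rcases not_mem_cases hΩb hδ (fun h => hRP hgR (hPfin.2 h)) with h | ⟨y, hgy, hny⟩
      · exact ⟨g, hgR, h⟩
      · by_cases hgD : g ∈ meshDomain Ω δ
        · have hyD : y ∉ meshDomain Ω δ := fun hyD => hny (discreteDomainGraph_adj_iff.2 ⟨hmeshAdj hgR hgy, hgD, hyD⟩)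
          exact ⟨y, hcl hgR hgy (fun hyP => hyD (mem_meshDomain_of_mem (hPfin.1 hyP))), hyD⟩
        · exact ⟨g, hgR, hgD⟩
    have hx₀v : x₀ ∈ meshVertices Ω δ := (hall _ hx₀R).1
    -- its mesh component misses `Ω_δ` and lies in `R`
    have hcompD : ∀ (v : meshVertices Ω δ), (meshVertexGraph Ω δ).Reachable ⟨x₀, hx₀v⟩ v → v.1 ∉ meshDomain Ω δ :=
      fun v hv hvD => hx₀D (mem_meshDomain_of_reachable' hvD hv.symm)
    have hcompR : ∀ (v : meshVertices Ω δ), (meshVertexGraph Ω δ).Reachable ⟨x₀, hx₀v⟩ v → v.1 ∈ R := by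
      intro v ⟨p⟩
      suffices h : ∀ (a c : meshVertices Ω δ) (q : (meshVertexGraph Ω δ).Walk a c),
          (meshVertexGraph Ω δ).Reachable ⟨x₀, hx₀v⟩ a → a.1 ∈ R → c.1 ∈ R from h _ _ p (Reachable.refl _) hx₀R
      intro a c q
      induction q with
      | nil => exact fun _ h => h
      | cons hadj q ih =>
        rename_i a' b' c'
        intro hra haR
        have hrb : (meshVertexGraph Ω δ).Reachable ⟨x₀, hx₀v⟩ b' := hra.trans hadj.reachable
        have hbD : b'.1 ∉ meshDomain Ω δ := hcompD b' hrb
        have hab : (zdGraph 2).Adj a'.1 b'.1 := meshGraph_le_zdGraph _ _ hadj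
        exact ih hrb (hcl haR hab (fun hbP => hbD (mem_meshDomain_of_mem (hPfin.1 hbP))))
    -- the topmost site of the component
    set C : Set (Site 2) := {x ∈ R | ∃ hx : x ∈ meshVertices Ω δ, (meshVertexGraph Ω δ).Reachable ⟨x₀, hx₀v⟩ ⟨x, hx⟩} with hC
    have hCfin : C.Finite := hRfin.subset (Set.sep_subset _ _)
    have hx₀C : x₀ ∈ hCfin.toFinset := hCfin.mem_toFinset.2 ⟨hx₀R, hx₀v, Reachable.refl _⟩
    obtain ⟨t, htC, htmax⟩ := hCfin.toFinset.exists_max_image (fun x : Site 2 => x 1) ⟨x₀, hx₀C⟩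
    obtain ⟨htR, htv, htreach⟩ := hCfin.mem_toFinset.1 htC
    set t' : Site 2 := t + cornerUnit 1 with ht'
    have htt' : (zdGraph 2).Adj t t' := zdGraph_adj_add_cornerUnit t 1
    have ht'1 : t' 1 = t 1 + 1 := by simp [ht', cornerUnit, Pi.add_apply]
    by_cases ht'Ω : meshPoint δ t' ∈ Ω
    · -- then `t'` is in the component, higher than `t`
      have hreach' : (meshVertexGraph Ω δ).Reachable ⟨x₀, hx₀v⟩ ⟨t', ht'Ω⟩ :=
        htreach.trans (SimpleGraph.Adj.reachable ((meshVertexGraph_adj_iff htv ht'Ω).2 (hmeshAdj htR htt')))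
      have ht'C : t' ∈ hCfin.toFinset := hCfin.mem_toFinset.2 ⟨hcompR _ hreach', ht'Ω, hreach'⟩
      have := htmax t' ht'C
      omega
    · -- else `t' ∈ R` is off `Ω`
      have ht'P : t' ∉ P := fun h => ht'Ω (meshPoint_mem_of_mem (hPfin.1 h))
      exact ht'Ω (hall _ (hcl htR htt' ht'P)).1
  obtain ⟨x, hxR, hx⟩ := hwit
  rcases hx with hxΩ | ⟨y, hxy, hseg⟩
  · -- `δ x ∉ Ω` is interior to the enclosure: exterior points nearby
    exact exists_mem_exterior_of_isOpen hΩo hJE isOpen_interior (meshPoint_mem_interior_cellUnion hδ hxR) hxΩ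
  · -- a segment of `x` leaving `Ω̄`: it lies inside the enclosure
    obtain ⟨p, hp, hpΩ⟩ := Set.not_subset.1 hseg
    have hyP : y ∉ P := fun h => hseg (segment_subset_of_mem' (hPfin.1 h) hxy)
    exact ⟨p, segment_subset_interior_cellUnion hδ hxR (hcl hxR hxy hyP) hxy hp, hpΩ⟩

end Enclosure

end MeshInteriorHoleFree

open MeshInteriorHoleFree

/-! ### Hole-freeness from lattice connectivity of the complement -/

/-- **A finite set of cells whose complement induces a preconnected subgraph of `ℤ²` is
hole-free** (the graph form in which `MeshApproximatesPolyomino.lean` delivers the complement of the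
free sites of a polyomino domain at fine meshes, `Polyomino.intSites_compl_preconnected`, converted
to the `HoleFree` form consumed by the Kadanoff–Ceva files). [folklore] -/
theorem holeFree_of_induce_compl_preconnected {P : Set (Site 2)} (hP : P.Finite)
    (hconn : ((zdGraph 2).induce Pᶜ).Preconnected) : HoleFree P := by
  intro g hg M
  -- a cell of the column of `g`, above `P` and above height `M`
  obtain ⟨Y, hY⟩ := (hP.image fun f : Site 2 => f 1).bddAbove
  set g' : Site 2 := ![g 0, max M (Y + 1)] with hg'def
  have hg' : g' ∉ P := fun h => by
    have := hY ⟨g', h, rfl⟩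
    simp [hg'def] at this
  refine ⟨g', by simp [hg'def], ?_⟩
  obtain ⟨W⟩ := hconn ⟨g, hg⟩ ⟨g', hg'⟩
  -- a walk in the induced graph is a chain of steps between cells outside `P`
  suffices h : ∀ (a b : (Pᶜ : Set (Site 2))) (_ : ((zdGraph 2).induce (Pᶜ : Set (Site 2))).Walk a b),
      Relation.ReflTransGen (FaceStep P) a.1 b.1 from h _ _ W
  intro a b W'
  induction W' with
  | nil => exact Relation.ReflTransGen.refl
  | cons hadj W'' ih =>
    rename_i a₁ b₁ c₁
    exact Relation.ReflTransGen.head ⟨SimpleGraph.comap_adj.1 hadj, a₁.2, b₁.2⟩ ih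

/-- **The free sites of `Ω_δ ∖ ∂Ω_δ` are hole-free** (at every mesh) for an open set `Ω` whose
exterior `(closure Ω)ᶜ` is connected and accumulates at every boundary point: every cell outside
`meshInteriorFinset Ω δ` is joined to cells of arbitrary height through side-adjacent cells outside
it — the "simply connected discrete domain" hypothesis of CHI15 §2.1 (`HoleFree`, consumed by
`exists_kcCuts_primitive_mesh` and the Kramers–Wannier duality of `KramersWannierDisorder.lean`)
for the tree's discretisation scheme. [cite: ChelkakHonglerIzyurovAnnals2015, §2.1 (simply connected discrete domains)] -/
theorem holeFree_meshInteriorFinset {Ω : Set ℂ} (hΩo : IsOpen Ω) (hV : IsConnected (closure Ω)ᶜ)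
    (hJE : frontier Ω ⊆ closure (closure Ω)ᶜ) (δ : ℝ) :
    HoleFree (↑(meshInteriorFinset Ω δ) : Set (Site 2)) := by
  classical
  by_cases h : Bornology.IsBounded Ω ∧ 0 < δ
  swap
  · -- empty volume: every cell escapes straight up
    have hempty : meshInteriorFinset Ω δ = ∅ := by unfold meshInteriorFinset; rw [dif_neg h]
    intro g hg M
    obtain ⟨n, hn⟩ : ∃ n : ℕ, M ≤ g 1 + n := ⟨(M - g 1).toNat, by omega⟩
    refine ⟨g + n • cornerUnit 1, ?_, reflTransGen_faceStep_nsmul hg Relation.ReflTransGen.refl 1 (fun m => by simp [hempty]) n⟩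
    rw [add_nsmul_cornerUnit_apply]; simpa [cornerUnit] using hn
  obtain ⟨hΩb, hδ⟩ := h
  intro g hg M
  by_contra hcon
  push Not at hcon
  have hM : ∀ r, Relation.ReflTransGen (FaceStep (↑(meshInteriorFinset Ω δ) : Set (Site 2))) g r → r 1 < M :=
    fun r hr => not_le.1 fun h => hcon r h hr
  obtain ⟨X₁, X₂, Y₁, hbox⟩ := exists_box Ω δ
  have hRfin := MeshInteriorHoleFree.finite_reach hbox hg hM
  obtain ⟨x, hxK, hxV⟩ := exists_mem_interior_cellUnion hδ hg hΩo hΩb hJE hRfin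
  exact not_mem_interior_cellUnion hδ hg hΩb hV hRfin hxK hxV

/-- **For a Jordan domain the free sites of `Ω_δ ∖ ∂Ω_δ` are hole-free at every mesh** (the two
hypotheses of `holeFree_meshInteriorFinset` are the tree's Jordan curve theorem:
`JordanDomain.exterior_of_JCT`, `JordanDomain.frontier_subset_closure_exterior`). This discharges the
hypothesis `HoleFree ↑(meshInteriorFinset Ω δ)` of `exists_kcCuts_primitive_mesh` for Jordan
domains. [cite: ChelkakHonglerIzyurovAnnals2015, §2.1 (simply connected discrete domains)] -/
theorem _root_.Literature.Probability.RandomPlanarGeometry.JordanDomain.holeFree_meshInteriorFinset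
    (D : JordanDomain) (δ : ℝ) : HoleFree (↑(meshInteriorFinset D.carrier δ) : Set (Site 2)) := by
  obtain ⟨hVconn, -, -⟩ := D.exterior_of_JCT Literature.Topology.PlaneTopology.JordanCurveTheorem_holds
  exact Literature.Probability.LatticeModels.holeFree_meshInteriorFinset D.isOpen hVconn
    (D.frontier_subset_closure_exterior Literature.Topology.PlaneTopology.JordanCurveTheorem_holds) δ

end Literature.Probability.LatticeModels
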